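import Mathlib
import Summits.Ventures.PercRepro2.Defs
import Summits.Ventures.PercRepro2.Graph
import Summits.Ventures.PercRepro2.OneColourSwitch
import Summits.Ventures.PercRepro2.M9PocketUnitFibreSum
import Summits.Ventures.PercRepro2.M9PocketPsi2Sign
import Summits.Ventures.PercRepro2.M9PocketProdSkel
import Summits.Ventures.PercRepro2.M9PocketUnitFibreSumT

/-!
# [`T`-edge chain] # The normalisation of a `K`-only point: the `W`-side switched to the `Y`-side (blind cell
PercRepro2, p3 g39 / g40, 2026-08-29; `proofs/P3-POCKETRK.md` §10 (d): the free-block extension,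
part 7 — the skeleton map, pointwise)

For a `K`-only legal point `ω` (`Sep ∧ DOne`, `d ∈ K₂ ∖ M₂`) let `W = M₂(G − d) ∖ {r, s}` be its
`W`-side (the `W`-side free blocks) and `ω₁ = ω ⊕ touches W` the point with the `W`-side
switched to the `Y`-side.  The `W`-side is closed in the sided set of `G − d`
(`closedIn_wside`), so `K₂(G − d; ω₁) = K₂(G − d; ω) ∪ W` and `M₂(G − d; ω₁) ⊆ {r, s}`
(`K2_endsD_norm`, `M2_endsD_norm`).  In `G`: every outside vertex of the cluster of `d` at
`ω₁` is in the cluster at `ω` (`cluster_norm_subset`), `r` and `s` have no closed edge at `ω₁`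
(`cluster_compl_mark_norm`), `K₂(ω₁) ⊆ K₂(ω) ∪ W` (`K2_norm_subset`), and `ω₁` is a `K`-only
legal point (`norm_legal`).  T-VARIANT (p3 g39, `proofs/P3-POCKETRK.md` §10‴): the hypothesis «no `d r`, `d s` edge» is
replaced by `hM : d ∉ M₂(ρ)` (every `T`-edge is `Y` at a `K`-only point); the lemmas carry the
suffix `_T`, the `hT`-free lemmas are those of the original file.  Own work; std axioms.
-/

namespace Summit.Ventures.PercRepro2

namespace NoPocket

open Finset Classical OneColourSwitch SideSwitch

variable {V : Type*} {E : Type*} {ends : E → Sym2 V} {p q r s d : V} {ω : Config E}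

section Norm

variable (hdr : d ≠ r) (hds : d ≠ s) (hrs : within ends ({r, s} : Set V) = ∅)
  (hsep : sep2 ends p q r s ω) (hD : DOne ends r s d ω) (hK : d ∈ K2 ends r s ω)
  (hM : d ∉ M2 ends r s ω)

include hdr hds hrs hM hsep hD in
/-- **After the switch, `r` and `s` have no closed edge**: the root edges of the `W`-side are
flipped to `Y`, the other root edges are `Y` already. -/
lemma cluster_compl_mark_norm_T {t : V} (ht : t = r ∨ t = s) :
    cluster ends (OneColourSwitch.compl (flipTouch (endsD ends d)
      {x : V | x ∈ M2 (endsD ends d) r s ω ∧ x ≠ r ∧ x ≠ s} ω)) t = {t} := by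
  set W := {x : V | x ∈ M2 (endsD ends d) r s ω ∧ x ≠ r ∧ x ≠ s} with hW
  set ω₁ := flipTouch (endsD ends d) W ω with hω₁
  have hsepD := sep2_endsD_of_sep2 (d := d) hsep
  have hDz := DZero_endsD_of_DOne hdr hds hD
  have htd : t ≠ d := by rcases ht with rfl | rfl; exact hdr.symm; exact hds.symm
  have htW : t ∉ W := by rcases ht with rfl | rfl; exact fun h => h.2.1 rfl; exact fun h => h.2.2 rfl
  ext y
  simp only [Set.mem_singleton_iff, mem_cluster]
  constructor
  · intro hy
    have key : y ∈ {z | z = t} := by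
      refine mem_of_conn_of_closed ?_ rfl hy
      rintro a ha b hab
      simp only [Set.mem_setOf_eq] at ha ⊢
      subst ha
      exfalso
      obtain ⟨hne, e, he, hends⟩ := openGraph_adj.1 hab
      have he' : ω₁ e = false := by
        simp only [OneColourSwitch.compl, Bool.not_eq_true'] at he; exact he
      have hbrs : ¬ (b = r ∨ b = s) := by
        intro hb
        have : e ∈ within ends ({r, s} : Set V) := by
          refine ⟨a, ?_, b, ?_, hends⟩
          · rcases ht with rfl | rfl <;> simp
          · rcases hb with rfl | rfl <;> simp
        rw [hrs] at this; exact this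
      have hbd : b ≠ d := by
        -- a closed edge from `t ∈ {r, s}` to `d` would be a `T`-edge: it touches no `W`-side
        -- vertex (`d ∉ M₂(G − d)`), so the switch leaves it closed, and `d ∈ M₂(ω)` — against `hM`
        intro hbd'
        subst b
        have hde : d ∈ ends e := by rw [hends]; exact Sym2.mem_mk_right _ _
        have hnt : e ∉ touches (endsD ends d) W := by
          rintro ⟨z, hz, w, hzw⟩
          rw [endsD_of_mem hde, Sym2.eq_iff] at hzw
          have hzd : z = d := by rcases hzw with ⟨h, _⟩ | ⟨_, h⟩ <;> exact h.symm
          exact not_mem_M2_endsD hdr hds ω (hzd ▸ hz.1)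
        rw [hω₁, flipTouch_of_notMem _ hnt] at he'
        have haM' : a ∈ M2 ends r s ω := by
          rcases ht with rfl | rfl
          · exact r_mem_M2 a s ω
          · exact s_mem_M2 r a ω
        exact hM (mem_M2_of_closed haM' he' hends)
      have hde : d ∉ ends e := notMem_of_ends_ne hends htd hbd
      have haM : a ∈ M2 (endsD ends d) r s ω := by
        rcases ht with rfl | rfl
        · exact r_mem_M2 a s ω
        · exact s_mem_M2 r a ω
      have haK : a ∈ K2 (endsD ends d) r s ω := by
        rcases ht with rfl | rfl
        · exact r_mem_K2 a s ω
        · exact s_mem_K2 r a ω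
      by_cases hbW : b ∈ W
      · -- the root edge of a `W`-side block: `W` at `ω`, flipped to `Y`
        rw [hω₁, flipTouch_of_mem _ ⟨b, hbW, a, by rw [endsD_of_notMem hde, hends, Sym2.eq_swap]⟩]
          at he'
        have hρe : ω e = true := by
          cases h : ω e
          · rw [h] at he'; exact absurd he' (by decide)
          · rfl
        exact hDz b (fun h => hbrs (Or.inl h)) (fun h => hbrs (Or.inr h))
          (mem_K2_of_open haK hρe (by rw [endsD_of_notMem hde, hends])) hbW.1
      · -- an unchanged edge: `W` at `ω`, so `b` is `W`-side or `r, s`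
        have hnt : e ∉ touches (endsD ends d) W := by
          rintro ⟨z, hz, w, hzw⟩
          rw [endsD_of_notMem hde, hends, Sym2.eq_iff] at hzw
          rcases hzw with ⟨h1, _⟩ | ⟨_, h1⟩
          · exact htW (h1 ▸ hz)
          · exact hbW (h1 ▸ hz)
        rw [hω₁, flipTouch_of_notMem _ hnt] at he'
        have hbM : b ∈ M2 (endsD ends d) r s ω :=
          mem_M2_of_closed haM he' (by rw [endsD_of_notMem hde, hends])
        exact hbW ⟨hbM, fun h => hbrs (Or.inl h), fun h => hbrs (Or.inr h)⟩
    exact key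
  · rintro rfl
    exact conn_refl _ _ _

include hdr hds hrs hM hsep hD hK in
/-- **The switched point is a `K`-only legal point without a `W`-side.** -/
lemma norm_legal_T (hp : p ≠ d) (hq : q ≠ d) :
    sep2 ends p q r s (flipTouch (endsD ends d)
        {x : V | x ∈ M2 (endsD ends d) r s ω ∧ x ≠ r ∧ x ≠ s} ω) ∧
      DOne ends r s d (flipTouch (endsD ends d)
        {x : V | x ∈ M2 (endsD ends d) r s ω ∧ x ≠ r ∧ x ≠ s} ω) ∧
      d ∈ K2 ends r s (flipTouch (endsD ends d)
        {x : V | x ∈ M2 (endsD ends d) r s ω ∧ x ≠ r ∧ x ≠ s} ω) ∧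
      d ∉ M2 ends r s (flipTouch (endsD ends d)
        {x : V | x ∈ M2 (endsD ends d) r s ω ∧ x ≠ r ∧ x ≠ s} ω) := by
  set W := {x : V | x ∈ M2 (endsD ends d) r s ω ∧ x ≠ r ∧ x ≠ s} with hW
  set ω₁ := flipTouch (endsD ends d) W ω with hω₁
  have hsepD := sep2_endsD_of_sep2 (d := d) hsep
  have hM2 : ∀ x, x ∈ M2 ends r s ω₁ → x = r ∨ x = s := by
    intro x hx
    rcases mem_M2_iff.1 hx with hc | hc
    · have := cluster_compl_mark_norm_T hdr hds hrs hsep hD hM (Or.inl rfl)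
      have hx' : x ∈ cluster ends (OneColourSwitch.compl ω₁) r := hc
      rw [this] at hx'; exact Or.inl hx'
    · have := cluster_compl_mark_norm_T hdr hds hrs hsep hD hM (Or.inr rfl)
      have hx' : x ∈ cluster ends (OneColourSwitch.compl ω₁) s := hc
      rw [this] at hx'; exact Or.inr hx'
  have hK2 := K2_norm_subset hdr hds hsep hD hK hM
  obtain ⟨⟨hpK, hqK⟩, ⟨hpM, hqM⟩⟩ := sep2_iff.1 hsepD
  obtain ⟨⟨hpK', hqK'⟩, ⟨hpM', hqM'⟩⟩ := sep2_iff.1 hsep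
  have hcl : ∀ x, x ∈ cluster ends ω d → x ∈ K2 ends r s ω := by
    intro x hx
    rcases mem_K2_iff.1 hK with hc | hc
    · exact mem_K2_iff.2 (Or.inl (conn_trans hc hx))
    · exact mem_K2_iff.2 (Or.inr (conn_trans hc hx))
  refine ⟨?_, ?_, ?_, ?_⟩
  · rw [sep2_iff]
    refine ⟨⟨fun h => ?_, fun h => ?_⟩, ⟨fun h => ?_, fun h => ?_⟩⟩
    · rcases hK2 h with h' | h' | h' | h'
      · exact hpK h'
      · exact hpM h'
      · exact hp h'
      · exact hpK' (hcl p h')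
    · rcases hK2 h with h' | h' | h' | h'
      · exact hqK h'
      · exact hqM h'
      · exact hq h'
      · exact hqK' (hcl q h')
    · rcases hM2 p h with h' | h'
      · exact hpM' (by rw [h']; exact r_mem_M2 r s ω)
      · exact hpM' (by rw [h']; exact s_mem_M2 r s ω)
    · rcases hM2 q h with h' | h'
      · exact hqM' (by rw [h']; exact r_mem_M2 r s ω)
      · exact hqM' (by rw [h']; exact s_mem_M2 r s ω)
  · intro x hxr hxs _ _ hxM
    rcases hM2 x hxM with h | h
    · exact hxr h
    · exact hxs h
  · -- the `Y` edge of `d` into a joined block is unchanged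
    obtain ⟨e, y, hey, he, hy⟩ := exists_open_edge_d_of_mem_K2 hdr hds hK
    have hyW : y ∉ W := fun h =>
      DZero_endsD_of_DOne hdr hds hD y h.2.1 h.2.2 hy h.1
    have hnt : e ∉ touches (endsD ends d) W := by
      rintro ⟨z, hz, w, hzw⟩
      rw [endsD_of_mem (by rw [hey]; exact Sym2.mem_mk_left _ _), Sym2.eq_iff] at hzw
      have hzd : z = d := by rcases hzw with ⟨h, _⟩ | ⟨_, h⟩ <;> exact h.symm
      exact not_mem_M2_endsD hdr hds ω (hzd ▸ hz.1)
    have hyK : y ∈ K2 (endsD ends d) r s ω₁ := by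
      rw [hω₁, K2_endsD_norm hdr hds hsep hD]; exact Or.inl hy
    refine mem_K2_of_open (K2_endsD_subset_K2 _ hyK) ?_ (by rw [hey, Sym2.eq_swap])
    rw [hω₁, flipTouch_of_notMem _ hnt]; exact he
  · intro h
    rcases hM2 d h with h' | h'
    · exact hdr h'
    · exact hds h'

include hdr hds hrs hsep hD hK hM in
/-- **`σ_rs ≥ 0` at the switched point**: its `W`-world of `{r, s}` in `G − d` is inside
`{r, s}` and `d ∉ M₂` there, so `r` and `s` are not `W`-connected (`T`-edges allowed). -/
lemma sigma_rs_norm_nonneg_T (hp : p ≠ d) (hq : q ≠ d) :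
    0 ≤ sigma ends (flipTouch (endsD ends d)
      {x : V | x ∈ M2 (endsD ends d) r s ω ∧ x ≠ r ∧ x ≠ s} ω) r s := by
  obtain ⟨_, _, _, hM₁⟩ := norm_legal_T hdr hds hrs hsep hD hK hM hp hq
  exact sigma_rs_nonneg_of_noWside_T hdr hds hrs hM₁ (M2_endsD_norm hdr hds hsep hD)

end Norm

end NoPocket

end Summit.Ventures.PercRepro2
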